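import Mathlib
import HarnessLib
import Literature.MathematicalPhysics.QuantumFieldTheory.ConstructiveQFTWave0
import Literature.MathematicalPhysics.QuantumLattice.AbelianFieldTensor
import Literature.MathematicalPhysics.QuantumLattice.AbelianMagneticFlux
import Summits.Ventures.LatticeQCDFlow.Scaling.CircleBallVolume
import Summits.Ventures.LatticeQCDFlow.Scaling.TopologicalCollar
import Summits.Ventures.LatticeQCDFlow.Scaling.FluxSectorCollar
import Summits.Ventures.LatticeQCDFlow.Scaling.SectorConfinement
import Summits.Ventures.LatticeQCDFlow.Scaling.SliceTwistWitness

/-!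
# LatticeQCDFlow / Scaling — the strip winding: a `π/m`-thin sector-changing update supported in a `2 × m` block (v3.5, (C7b″) for CONTRACTIBLE update sets)

HONEST FRAMING: exact (Metropolis-corrected) sampling algorithms for lattice gauge theory; figures
of merit are autocorrelation/cost numbers at stated couplings and volumes; no continuum-physics
claim.

THEORY-2.md §4 (C7), §5.15.  `SliceTwistWitness.lean` / `SliceTwistPair.lean` show that a
thin-plaquette tunnelling law for an update set WRAPPING the torus (a line of `L` links) cannot have
a threshold above `2π/L`.  The solid-BOX law `Lattice.compProd_sector_ne_le_of_box`
(`BoxPatchSectors.lean`) has threshold `c(l) = ρ/(2·4^{2l-4})` for a box of side `l`; this file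
shows that for boxes, too, the threshold must shrink with the side — at least like `π/m` for a box
containing a `2 × m` block of sites — by the lattice form of the WINDING MOVE of
[cite: AlbandeaEtAl2021, §3]: a gauge transformation `Ω` with winding number one on the boundary
cycle of the block, applied only to the links with both endpoints in the block.

* `stripWinding m` (`d = 2`, `U(1)`, sites `{1,2} × {1,…,m}`): the horizontal link at `(1, j)`
  carries `e^{-iπ(2j-1)/m}`, the vertical links at `(1, j)` / `(2, j)` (`1 ≤ j ≤ m-1`) carry
  `e^{± iπ/m}`; every other link is `1` (`stripWinding_eq_one_of_not_mem`: the support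
  `stripSupport m` consists of links with both endpoints in the block).
* `plaquetteHolonomy_stripWinding` (`2 ≤ m`, `m + 2 ≤ L`): every plaquette is `1` or `e^{iπ/m}` —
  the latter exactly on the `2m` plaquettes adjacent to the block from outside; hence every
  plaquette is within chordal distance `2 sin(π/(2m)) ≤ π/m` of `1`
  (`dist_plaquetteHolonomy_stripWinding_le`), and the flux charge is
  `topCharge 0 0 1 (stripWinding m) = 1` (`topCharge_stripWinding`).
* `exists_thin_pair_sector_ne_strip`: for `π/m < ε ≤ 2` the trivial configuration and the strip
  winding are two `ε`-thin configurations agreeing off `stripSupport m` in DIFFERENT `ε`-sectors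
  (`ε`-sectors refine flux sectors, `topCharge_eq_of_mem_connectedComponentIn`).

SCOPE (honest reading).  (i) `U(1)`, `d = 2` only; the block must not wrap (`m + 2 ≤ L`).  (ii) The
sequel `StripWindingPair.lean` turns the pair into an invariant Markov pair and states the
threshold-necessity for every update set containing `stripSupport m` (in particular solid boxes of
side `l ≥ m` based at `(1,1)`): no law `(μ ⊗ κ){sector_ε ≠} ≤ C·μ{∃ p, dist(U_p,1) ≥ c}` with
`c > π/m`.  (iii) Under the Wilson measure the strip winding costs
`S = 2m(1 - cos(π/m)) ≃ π²/m` at `β = 1` — the printed `⟨ΔS⟩ ≃ βπ²/(2L_w)` of the square winding of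
side `L_w` (perimeter `4L_w` vs `2m` here) [cite: AlbandeaEtAl2021, §3, p.7]; nothing in this file
is a statement about `μ_β`.
-/

noncomputable section

namespace Summit.Ventures.LatticeQCDFlow.Theory2.Lattice.Flux

open MeasureTheory Metric Set Filter Topology Real
open Literature.MathematicalPhysics.QuantumFieldTheory Literature.MathematicalPhysics.QuantumLattice

variable {L : ℕ} [NeZero L] {m : ℕ}

/-! ## §1. The strip winding and its links -/

/-- **The strip winding** on the block of sites `{1,2} × {1,…,m}`: `U^Ω = Ω(x) Ω(x+μ)⁻¹` on links
with both endpoints in the block, `Ω(1,j) = e^{-iπj/m}`, `Ω(2,j) = e^{iπ(j-1)/m}` (winding number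
one around the boundary cycle), written out link by link; `1` elsewhere.
[cite: AlbandeaEtAl2021, §3] -/
def stripWinding (m : ℕ) : GaugeConfig 2 L Circle := fun e =>
  if e.2 = 0 then
    (if e.1 0 = 1 ∧ 1 ≤ (e.1 1).val ∧ (e.1 1).val ≤ m then
      Circle.exp (-(π * (2 * ((e.1 1).val : ℝ) - 1) / m)) else 1)
  else
    (if 1 ≤ (e.1 1).val ∧ (e.1 1).val + 1 ≤ m then
      (if e.1 0 = 1 then Circle.exp (π / m) else if e.1 0 = 2 then Circle.exp (-(π / m)) else 1)
    else 1)

/-- The support of the strip winding: links with both endpoints in the block. [folklore] -/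
def stripSupport (m : ℕ) : Set (Edge 2 L) :=
  {e | (e.2 = 0 ∧ e.1 0 = 1 ∧ 1 ≤ (e.1 1).val ∧ (e.1 1).val ≤ m) ∨
    (e.2 = 1 ∧ (e.1 0 = 1 ∨ e.1 0 = 2) ∧ 1 ≤ (e.1 1).val ∧ (e.1 1).val + 1 ≤ m)}

omit [NeZero L] in
/-- Horizontal links of the strip winding. [folklore] -/
theorem stripWinding_horiz (x : Site 2 L) :
    stripWinding m (x, 0) = if x 0 = 1 ∧ 1 ≤ (x 1).val ∧ (x 1).val ≤ m then
      Circle.exp (-(π * (2 * ((x 1).val : ℝ) - 1) / m)) else 1 := by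
  dsimp only [stripWinding]
  rw [if_pos rfl]

omit [NeZero L] in
/-- Vertical links of the strip winding. [folklore] -/
theorem stripWinding_vert (x : Site 2 L) :
    stripWinding m (x, 1) = if 1 ≤ (x 1).val ∧ (x 1).val + 1 ≤ m then
      (if x 0 = 1 then Circle.exp (π / m) else if x 0 = 2 then Circle.exp (-(π / m)) else 1)
      else 1 := by
  dsimp only [stripWinding]
  rw [if_neg (show (1 : Fin 2) ≠ 0 by decide)]

omit [NeZero L] in
/-- Off its support the strip winding is trivial. [folklore] -/
theorem stripWinding_eq_one_of_not_mem {e : Edge 2 L} (he : e ∉ stripSupport m) :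
    stripWinding m e = 1 := by
  obtain ⟨x, i⟩ := e
  simp only [stripSupport, Set.mem_setOf_eq, not_or, not_and] at he
  obtain ⟨h0, h1⟩ := he
  fin_cases i
  · rw [show ((fun i => i) ⟨0, by norm_num⟩ : Fin 2) = 0 from rfl, stripWinding_horiz]
    split_ifs with h
    · exact absurd h.2.2 (h0 rfl h.1 h.2.1)
    · rfl
  · rw [show ((fun i => i) ⟨1, by norm_num⟩ : Fin 2) = 1 from rfl, stripWinding_vert]
    split_ifs with h ha hb
    · exact absurd h.2 (h1 rfl (Or.inl ha) h.1)
    · exact absurd h.2 (h1 rfl (Or.inr hb) h.1)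
    · rfl
    · rfl

/-! ## §2. The plaquettes of the strip winding -/

omit [NeZero L] in
/-- Small numerals are distinct residues for `4 ≤ L`. [folklore] -/
theorem zmod_val_two (hL : 4 ≤ L) : (2 : ZMod L).val = 2 := by
  rw [← Nat.cast_ofNat, ZMod.val_natCast_of_lt (by omega)]

/-- **The plaquettes of the strip winding**: `e^{iπ/m}` on the `2m` plaquettes adjacent to the
block from outside (below `(1,1)`, above `(1,m)`, left of column `1`, right of column `2`), `1` on
all others (inside the block the winding is a gauge transformation). [folklore] -/
theorem plaquetteHolonomy_stripWinding (hm : 2 ≤ m) (hmL : m + 2 ≤ L) (x : Site 2 L) :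
    plaquetteHolonomy (stripWinding m) x 0 1 =
      if (x 0 = 1 ∧ ((x 1).val = 0 ∨ (x 1).val = m)) ∨
          ((x 0 = 0 ∨ x 0 = 2) ∧ 1 ≤ (x 1).val ∧ (x 1).val + 1 ≤ m)
      then Circle.exp (π / m) else 1 := by
  have h10 : (x.shift 1) 0 = x 0 := by simp [Site.shift]
  have h11 : (x.shift 1) 1 = x 1 + 1 := by simp [Site.shift]
  have h00 : (x.shift 0) 0 = x 0 + 1 := by simp [Site.shift]
  have h01 : (x.shift 0) 1 = x 1 := by simp [Site.shift]
  haveI : Fact (1 < L) := ⟨by omega⟩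
  have hvL : (x 1).val < L := ZMod.val_lt _
  have hval1 : (x 1 + 1).val = if (x 1).val + 1 = L then 0 else (x 1).val + 1 := by
    rw [ZMod.val_add, ZMod.val_one]
    split_ifs with h
    · rw [h, Nat.mod_self]
    · exact Nat.mod_eq_of_lt (by omega)
  have e1 : x 0 + 1 = 1 ↔ x 0 = 0 := add_eq_right
  have e2 : x 0 + 1 = 2 ↔ x 0 = 1 := by
    rw [show (2 : ZMod L) = 1 + 1 from one_add_one_eq_two.symm, add_left_inj]
  have d01 : (0 : ZMod L) ≠ 1 := by
    intro h; have := congrArg ZMod.val h; rw [ZMod.val_zero, ZMod.val_one] at this; omega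
  have d02 : (0 : ZMod L) ≠ 2 := by
    intro h; have := congrArg ZMod.val h; rw [ZMod.val_zero, zmod_val_two (by omega)] at this; omega
  have d12 : (1 : ZMod L) ≠ 2 := by
    intro h; have := congrArg ZMod.val h; rw [ZMod.val_one, zmod_val_two (by omega)] at this; omega
  have hper : Circle.exp (-(π * (2 * (m : ℝ) - 1) / m)) = Circle.exp (π / m) := by
    have hm0 : (m : ℝ) ≠ 0 := by exact_mod_cast (show m ≠ 0 by omega)
    rw [show -(π * (2 * (m : ℝ) - 1) / m) = π / m - 2 * π by field_simp; ring, Circle.exp_sub,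
      Circle.exp_two_pi, div_one]
  rw [plaquetteHolonomy, stripWinding_horiz, stripWinding_vert, stripWinding_horiz,
    stripWinding_vert, h10, h11, h00, h01]
  simp only [e1, e2, hval1]
  generalize hv : (x 1).val = v at *
  by_cases a1 : x 0 = 1
  · simp only [a1, d01.symm, d12, true_and, or_false, if_true, if_false, false_and]
    split_ifs <;> first
      | (exfalso; omega)
      | (simp only [mul_one, one_mul, inv_one]; done)
      | skip
    · -- interior rows: the winding is a gauge transformation
      simp only [← Circle.exp_neg, ← Circle.exp_add]
      rw [show (1 : Circle) = Circle.exp 0 from Circle.exp_zero.symm]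
      congr 1
      push_cast
      field_simp
      ring
    · -- top row `v = m`
      have hvm : v = m := by omega
      subst hvm
      simp only [mul_one, inv_one]
      exact hper
    · -- the row below the block, `v = 0`
      have hv0 : v = 0 := by omega
      subst hv0
      simp only [one_mul, mul_one, inv_one, ← Circle.exp_neg]
      congr 1
      push_cast
      ring
  · by_cases a0 : x 0 = 0
    · simp only [a0, d01, d02, true_or, false_and, false_or, if_true, if_false, true_and]
      split_ifs <;> simp
    · by_cases a2 : x 0 = 2
      · simp only [a2, d02.symm, d12.symm, or_true, false_and, false_or, if_true, if_false,
          true_and]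
        split_ifs <;> simp [← Circle.exp_neg]
      · simp only [a0, a1, a2, false_and, if_false, or_self]
        split_ifs <;> simp

/-! ## §3. Thin plaquettes, charge one -/

/-- `dist(e^{iπ/m}, 1) = 2 sin(π/(2m)) ≤ π/m`. [folklore] -/
theorem dist_exp_pi_div_le (m : ℕ) : dist (Circle.exp (π / m)) 1 ≤ π / m := by
  rw [← mul_one (Circle.exp (π / m)), Circle.dist_exp_mul_self, abs_mul, abs_two]
  calc 2 * |Real.sin (π / m / 2)| ≤ 2 * |π / (m : ℝ) / 2| :=
        mul_le_mul_of_nonneg_left Real.abs_sin_le_abs (by norm_num)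
    _ = π / m := by rw [abs_of_nonneg (by positivity)]; ring

/-- **Every plaquette of the strip winding is `π/m`-thin.** [folklore] -/
theorem dist_plaquetteHolonomy_stripWinding_le (hm : 2 ≤ m) (hmL : m + 2 ≤ L)
    (p : Plaquette 2 L) :
    dist (plaquetteHolonomy (stripWinding m) p.1 p.2.1.1 p.2.1.2) 1 ≤ π / m := by
  obtain ⟨h0, h1⟩ := plaquette_dirs_eq p
  rw [h0, h1, plaquetteHolonomy_stripWinding hm hmL]
  split_ifs
  · exact dist_exp_pi_div_le m
  · rw [dist_self]; positivity

/-- The field tensor of the strip winding: `π/m` on the `2m` plaquettes adjacent to the block,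
`0` elsewhere. [folklore] -/
theorem abelianFieldTensor_stripWinding (hm : 2 ≤ m) (hmL : m + 2 ≤ L) (y : Site 2 L) :
    abelianFieldTensor (stripWinding m) y 0 1 =
      if (y 0 = 1 ∧ ((y 1).val = 0 ∨ (y 1).val = m)) ∨
          ((y 0 = 0 ∨ y 0 = 2) ∧ 1 ≤ (y 1).val ∧ (y 1).val + 1 ≤ m)
      then π / m else 0 := by
  rw [abelianFieldTensor, plaquetteHolonomy_stripWinding hm hmL]
  split_ifs
  · have hm1 : (1 : ℝ) ≤ m := by exact_mod_cast (show 1 ≤ m by omega)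
    have hmpos : (0 : ℝ) < m := by linarith
    rw [Circle.coe_exp, Complex.arg_exp_mul_I, toIocMod_eq_self]
    constructor
    · have : 0 < π / (m : ℝ) := by positivity
      linarith [Real.pi_pos]
    · have : π / (m : ℝ) ≤ π := by
        rw [div_le_iff₀ hmpos]; nlinarith [Real.pi_pos]
      linarith
  · rw [Circle.coe_one, Complex.arg_one]

omit [NeZero L] in
/-- Sums over `ZMod L` of functions of the representative are sums over `range L`. [folklore] -/
theorem sum_zmod_val [NeZero L] (g : ℕ → ℝ) :
    ∑ t : ZMod L, g t.val = ∑ i ∈ Finset.range L, g i := by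
  obtain ⟨n, hn⟩ : ∃ n, L = n + 1 := ⟨L - 1, by have := Nat.pos_of_ne_zero (NeZero.ne L); omega⟩
  subst hn
  exact Fin.sum_univ_eq_sum_range (fun i => g i) (n + 1)

/-- The two end plaquettes (below and above the block). [folklore] -/
theorem sum_indicator_ends (hm : 2 ≤ m) (hmL : m + 2 ≤ L) :
    ∑ t : ZMod L, (if t.val = 0 ∨ t.val = m then (1 : ℝ) else 0) = 2 := by
  rw [sum_zmod_val (fun i => if i = 0 ∨ i = m then (1 : ℝ) else 0), Finset.sum_boole]
  have : (Finset.range L).filter (fun i => i = 0 ∨ i = m) = {0, m} := by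
    ext i
    simp only [Finset.mem_filter, Finset.mem_range, Finset.mem_insert, Finset.mem_singleton]
    omega
  rw [this, Finset.card_pair (by omega)]
  norm_num

/-- The `m - 1` side plaquettes of one column. [folklore] -/
theorem sum_indicator_sides (hm : 2 ≤ m) (hmL : m + 2 ≤ L) :
    ∑ t : ZMod L, (if 1 ≤ t.val ∧ t.val + 1 ≤ m then (1 : ℝ) else 0) = m - 1 := by
  rw [sum_zmod_val (fun i => if 1 ≤ i ∧ i + 1 ≤ m then (1 : ℝ) else 0), Finset.sum_boole]
  have : (Finset.range L).filter (fun i => 1 ≤ i ∧ i + 1 ≤ m) = Finset.Ico 1 m := by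
    ext i; simp only [Finset.mem_filter, Finset.mem_range, Finset.mem_Ico]; omega
  rw [this, Nat.card_Ico]
  push_cast [Nat.cast_sub (show 1 ≤ m by omega)]
  ring

/-- The total field tensor of the strip winding is `2m · π/m = 2π`. [folklore] -/
theorem sum_abelianFieldTensor_pattern (hm : 2 ≤ m) (hmL : m + 2 ≤ L) :
    ∑ s : ZMod L, ∑ t : ZMod L,
      (if (s = 1 ∧ (t.val = 0 ∨ t.val = m)) ∨ ((s = 0 ∨ s = 2) ∧ 1 ≤ t.val ∧ t.val + 1 ≤ m)
        then (π / m : ℝ) else 0) = 2 * π := by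
  haveI : Fact (1 < L) := ⟨by omega⟩
  have h01 : (0 : ZMod L) ≠ 1 := by
    intro h; have := congrArg ZMod.val h; rw [ZMod.val_zero, ZMod.val_one] at this; omega
  have h02 : (0 : ZMod L) ≠ 2 := by
    intro h; have := congrArg ZMod.val h; rw [ZMod.val_zero, zmod_val_two (by omega)] at this; omega
  have h12 : (1 : ZMod L) ≠ 2 := by
    intro h; have := congrArg ZMod.val h; rw [ZMod.val_one, zmod_val_two (by omega)] at this; omega
  have hsplit : ∀ s t : ZMod L,
      (if (s = 1 ∧ (t.val = 0 ∨ t.val = m)) ∨ ((s = 0 ∨ s = 2) ∧ 1 ≤ t.val ∧ t.val + 1 ≤ m)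
        then (π / m : ℝ) else 0) =
      (if s = 1 then (if t.val = 0 ∨ t.val = m then π / m else 0) else 0) +
      (if s = 0 then (if 1 ≤ t.val ∧ t.val + 1 ≤ m then π / m else 0) else 0) +
      (if s = 2 then (if 1 ≤ t.val ∧ t.val + 1 ≤ m then π / m else 0) else 0) := by
    intro s t
    by_cases a1 : s = 1
    · simp [a1, h01.symm, h12]
    · by_cases a0 : s = 0
      · simp [a0, h01, h02]
      · by_cases a2 : s = 2
        · simp [a2, h02.symm, h12.symm]
        · simp [a0, a1, a2]
  simp only [hsplit, Finset.sum_add_distrib]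
  rw [Finset.sum_comm (f := fun s t => if s = 1 then _ else 0),
    Finset.sum_comm (f := fun s t => if s = 0 then _ else 0),
    Finset.sum_comm (f := fun s t => if s = 2 then _ else 0)]
  simp only [Finset.sum_ite_eq', Finset.mem_univ, if_true]
  have hm0 : (m : ℝ) ≠ 0 := by exact_mod_cast (show m ≠ 0 by omega)
  have e1 : ∑ t : ZMod L, (if t.val = 0 ∨ t.val = m then π / m else 0)
      = (π / m) * ∑ t : ZMod L, (if t.val = 0 ∨ t.val = m then (1 : ℝ) else 0) := by
    rw [Finset.mul_sum]; refine Finset.sum_congr rfl fun t _ => ?_; split_ifs <;> simp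
  have e2 : ∑ t : ZMod L, (if 1 ≤ t.val ∧ t.val + 1 ≤ m then π / m else 0)
      = (π / m) * ∑ t : ZMod L, (if 1 ≤ t.val ∧ t.val + 1 ≤ m then (1 : ℝ) else 0) := by
    rw [Finset.mul_sum]; refine Finset.sum_congr rfl fun t _ => ?_; split_ifs <;> simp
  rw [e1, e2, sum_indicator_ends hm hmL, sum_indicator_sides hm hmL]
  field_simp
  ring

/-- **The strip winding has flux charge `1`.** [folklore] -/
theorem topCharge_stripWinding (hm : 2 ≤ m) (hmL : m + 2 ≤ L) :
    topCharge (0 : Site 2 L) 0 1 (stripWinding m) = 1 := by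
  have hcoord0 : ∀ s t : ZMod L,
      ((0 : Site 2 L) + Pi.single (0 : Fin 2) s + Pi.single (1 : Fin 2) t : Site 2 L) 0 = s := by
    intro s t; simp
  have hcoord1 : ∀ s t : ZMod L,
      ((0 : Site 2 L) + Pi.single (0 : Fin 2) s + Pi.single (1 : Fin 2) t : Site 2 L) 1 = t := by
    intro s t; simp
  unfold topCharge magneticFlux
  simp only [abelianFieldTensor_stripWinding hm hmL, hcoord0, hcoord1]
  rw [sum_abelianFieldTensor_pattern hm hmL]
  field_simp

/-- The strip winding is not the trivial configuration. [folklore] -/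
theorem stripWinding_ne_one (hm : 2 ≤ m) (hmL : m + 2 ≤ L) :
    stripWinding (L := L) m ≠ 1 := by
  intro h
  have h1 := topCharge_stripWinding (L := L) hm hmL
  rw [h, topCharge_one'] at h1
  norm_num at h1

/-! ## §4. Two thin configurations, agreeing off the block, in different `ε`-sectors -/

/-- The strip winding is `ε`-thin for every `ε > π/m`. [folklore] -/
theorem stripWinding_mem_thin (hm : 2 ≤ m) (hmL : m + 2 ≤ L) {ε : ℝ} (hε : π / m < ε) :
    stripWinding m ∈ Thin L ε :=
  fun p => (dist_plaquetteHolonomy_stripWinding_le hm hmL p).trans_lt hε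

/-- **The strip winding is not in the `ε`-sector of the trivial configuration** (`ε ≤ 2`): charge
`1 ≠ 0` and `ε`-sectors refine flux sectors. [folklore] -/
theorem stripWinding_not_mem_connectedComponentIn_one (hm : 2 ≤ m) (hmL : m + 2 ≤ L) {ε : ℝ}
    (hε : ε ≤ 2) : stripWinding m ∉ connectedComponentIn (Thin L ε) 1 := by
  intro h
  have h1 := topCharge_eq_of_mem_connectedComponentIn hε (0 : Site 2 L) (μ := 0) (ν := 1)
    (by decide) h
  rw [topCharge_stripWinding hm hmL, topCharge_one'] at h1
  norm_num at h1

/-- The `ε`-sectors of the trivial configuration and of the strip winding differ (`0 < ε ≤ 2`).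
[folklore] -/
theorem connectedComponentIn_one_ne_stripWinding (hm : 2 ≤ m) (hmL : m + 2 ≤ L) {ε : ℝ}
    (hε0 : 0 < ε) (hε : ε ≤ 2) :
    connectedComponentIn (Thin L ε) 1 ≠ connectedComponentIn (Thin L ε) (stripWinding m) := by
  intro h
  have h1 : (1 : GaugeConfig 2 L Circle) ∈ connectedComponentIn (Thin L ε) (stripWinding m) := by
    rw [← h]; exact mem_connectedComponentIn (one_mem_thin hε0)
  have h2 : stripWinding m ∈ Thin L ε := connectedComponentIn_nonempty_iff.mp ⟨1, h1⟩
  have h3 : stripWinding m ∈ connectedComponentIn (Thin L ε) 1 := by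
    rw [h]; exact mem_connectedComponentIn h2
  exact stripWinding_not_mem_connectedComponentIn_one hm hmL hε h3

/-- **Non-vacuity of the sector-change event on a contractible block.**  For `2 ≤ m`,
`m + 2 ≤ L` and `π/m < ε ≤ 2` there are two `ε`-thin configurations agreeing off the links of the
`2 × m` block (`stripSupport m`) and lying in different `ε`-sectors. [cite: AlbandeaEtAl2021, §3] -/
theorem exists_thin_pair_sector_ne_strip (hm : 2 ≤ m) (hmL : m + 2 ≤ L) {ε : ℝ} (hε : π / m < ε)
    (hε2 : ε ≤ 2) :
    ∃ U U' : GaugeConfig 2 L Circle, U ∈ Thin L ε ∧ U' ∈ Thin L ε ∧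
      (∀ e ∉ stripSupport m, U e = U' e) ∧
      connectedComponentIn (Thin L ε) U ≠ connectedComponentIn (Thin L ε) U' :=
  have hε0 : 0 < ε := lt_of_le_of_lt (by positivity) hε
  ⟨1, stripWinding m, one_mem_thin hε0, stripWinding_mem_thin hm hmL hε, fun _ he =>
    (stripWinding_eq_one_of_not_mem he).symm,
    connectedComponentIn_one_ne_stripWinding hm hmL hε0 hε2⟩

end Summit.Ventures.LatticeQCDFlow.Theory2.Lattice.Flux
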